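import Summits.BirchSwinnertonDyer.BirchSwinnertonDyer.Theorems.PrintCFramBottomClassIndexLawFiveLeCuspSeedSquarefreeDensity
import Summits.BirchSwinnertonDyer.BirchSwinnertonDyer.Theorems.PrintCFramBottomClassIndexLawFiveLeCuspSeedFamilyLocalMeans
import Summits.BirchSwinnertonDyer.BirchSwinnertonDyer.Theorems.PrintCFramBottomClassIndexLawFiveLeCuspSeedFamilyWeight
import Summits.BirchSwinnertonDyer.BirchSwinnertonDyer.Theorems.PrintCFramBottomClassIndexLawFiveLeCuspSeedCoprimeMoebiusEuler
import HarnessLib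

set_option autoImplicit false

/-!
# Crux `PrintCFram.BottomClassIndexLawFiveLe` (stmt-BirchSwinnertonDyer-20372), line `eisenstein-resource-bdp-line` (registry v24):
# LEMMA D OF THE CUSP SEED — THE FAMILY MEAN VALUES: the Dirichlet density of `χ_{e*d}(n)` over the (3,0)-cut family of odd
# negative fundamental discriminants (cell `bsd-print-cfram`, width seat `bsd-line-cfram-p1-w3` g13; THEOREMS ONLY, `--supports`
# 20372; Mathlib currency; BSD is not proved by any of this)

HONEST FRAMING. Analytic number theory only (no elliptic curve, no BSD): ingredient (D) of the proof plan for the cusp conjunct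
«`G = 0 ⟹ ι C = 0`» of `CuspSeed.cuspSeed_six_of_cutForm` (crux notes `Lines/eisenstein-resource-bdp-line-w5g5-cusp-seed.md` §4,
§15 (D)). The family is `F = {d = −N : N squarefree, N ≡ 3 (4), [N ≡ 7 (8) if 2 ∣ m], (−N/q) = +1 ∀ odd primes q ∣ m, 3 ∤ N}`
(the (3,0)-cut of the registered `stub_cuspCutForm`, read on the squarefree part `N` of the index `n' = N f²`), and for
`n ⊥ m` the character value `χ_{e*d}(n)` is `(n/m)·(n/N)`; this file computes, for every fixed `n ≥ 1` prime to `m`,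

  **`lim_{σ→1⁺} (σ − 1) Σ_{N ∈ F} (n/N) N^{−σ} = D(m, n)`**,
  `D(m,n) = [n = □] · L(𝟙_{⊥6mn}·μ, 2) · (1/4 resp. 1/8) · (2/3 resp. 1) · ∏_{q ∣ m odd} (q−1)/(2q) · ∏_{ℓ ∣ n, ℓ ∤ 6m} (1 − 1/ℓ)`

(`tendsto_sub_one_mul_LSeries_family`; `1/8` when `2 ∣ m`, `1` when `3 ∣ m` — then `q = 3` sits in the product). With
`L(𝟙_{⊥6mn}μ, 2) = L(𝟙_{⊥6m}μ, 2)·∏_{ℓ∣n, ℓ∤6m}(1 − ℓ^{−2})^{−1}` this is w5 g5's `dens(F)·∏_{ℓ^v ∥ n} c_ℓ(v)`,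
`c_ℓ(v) = [v even]·ℓ/(ℓ+1)`. INGREDIENTS (all in the tree, this seat): the analytic core `FamilyMean.tendsto_sub_one_mul_LSeries_squarefree`
(Dirichlet density of a squarefree-supported periodic weight), the weight algebra `familyWeight_sq_mul` /
`familyWeight_eq_sign_mul_prod` / `periodic_familyWeight`, the CRT splitting `sum_range_mul_prod_eq` and the local Legendre means.
The assembly (E) of the cusp constant consumes this per fixed `n` (Tannery over `(a, b)`, uniform bound
`eventually_norm_sub_one_mul_LSeries_le`). Standard. [folklore]
-/

-- summit-side namespace `Summit.BirchSwinnertonDyer.BirchSwinnertonDyer.…` (single-conjunct summit, D-0017 layout)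
set_option linter.dupNamespace false

namespace Summit.BirchSwinnertonDyer.BirchSwinnertonDyer.Theorems.PrintCFram.FamilyMean

open Filter Topology Finset
open scoped NumberTheorySymbols Classical ArithmeticFunction.Moebius

/-! ### §1. Squares and parities of exponents -/

/-- A square has even exponent at every prime. [folklore] -/
theorem even_factorization_of_isSquare' {n : ℕ} (h : IsSquare n) (p : ℕ) : Even (n.factorization p) := by
  obtain ⟨r, rfl⟩ := h
  rcases eq_or_ne r 0 with rfl | hr
  · simp
  · rw [Nat.factorization_mul hr hr, Finsupp.add_apply]
    exact ⟨_, rfl⟩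

/-- A non-square `n ≠ 0` has a prime factor with odd exponent. [folklore] -/
theorem exists_mem_primeFactors_odd_factorization {n : ℕ} (hn : n ≠ 0) (h : ¬ IsSquare n) :
    ∃ p ∈ n.primeFactors, Odd (n.factorization p) := by
  by_contra hcon
  push Not at hcon
  apply h
  have hev : ∀ p, Even (n.factorization p) := by
    intro p
    by_cases hp : p ∈ n.primeFactors
    · exact Nat.not_odd_iff_even.mp (hcon p hp)
    · rw [← Nat.support_factorization, Finsupp.notMem_support_iff] at hp
      rw [hp]
      exact Even.zero
  -- `n = (∏ p^{v_p/2})²`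
  refine ⟨n.factorization.prod fun p e ↦ p ^ (e / 2), ?_⟩
  conv_lhs => rw [← Nat.prod_factorization_pow_eq_self hn]
  rw [Finsupp.prod, Finsupp.prod, ← Finset.prod_mul_distrib]
  refine Finset.prod_congr rfl fun p _ ↦ ?_
  rw [← pow_add]
  congr 1
  obtain ⟨k, hk⟩ := hev p
  omega

/-- If `n` is a square then so is its odd part, whence `⌊n'/2⌋` is even (`n' ≡ 1 (mod 8)`). [folklore] -/
theorem even_ordCompl_two_div_two {n : ℕ} (hn : n ≠ 0) (h : IsSquare n) : Even (ordCompl[2] n / 2) := by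
  obtain ⟨r, rfl⟩ := h
  rw [Nat.ordCompl_mul]
  have hr : r ≠ 0 := by rintro rfl; exact hn rfl
  have hodd : Odd (ordCompl[2] r) := odd_ordCompl_two hr
  -- an odd square is `1 mod 8`
  have h8 : (ordCompl[2] r * ordCompl[2] r) % 8 = 1 := by
    have h : ordCompl[2] r % 8 = 1 ∨ ordCompl[2] r % 8 = 3 ∨ ordCompl[2] r % 8 = 5 ∨
        ordCompl[2] r % 8 = 7 := by
      rw [Nat.odd_iff] at hodd
      omega
    rw [Nat.mul_mod]
    rcases h with h | h | h | h <;> simp [h]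
  rw [Nat.even_iff]
  omega

/-! ### §2. The family mean -/

/-- **LEMMA D (family mean values of the cusp seed).** For `m, n ≥ 1` with `n ⊥ m`, the Dirichlet density of the Jacobi
symbol `(n/N)` over the (3,0)-cut family of squarefree `N` —
`N ≡ 3 (mod 4)`, [`N ≡ 7 (mod 8)` if `2 ∣ m`], `(−N/q) = +1` for every odd prime `q ∣ m`, `3 ∤ N` — is
`lim_{σ→1⁺} (σ−1)·Σ_N (n/N) N^{−σ} = [n = □] · L(𝟙_{⊥6mn}·μ, 2) · c₂ · c₃ · ∏_{q ∣ m, q odd} (q−1)/(2q) · ∏_{ℓ ∣ n, ℓ ∤ 6m} (1 − 1/ℓ)`,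
`c₂ = 1/8` if `2 ∣ m` else `1/4`, `c₃ = 1` if `3 ∣ m` else `2/3`. [folklore] -/
theorem tendsto_sub_one_mul_LSeries_family {m n : ℕ} (hm : m ≠ 0) (hn : n ≠ 0) (hmn : n.Coprime m) :
    Tendsto (fun σ : ℝ ↦ ((σ : ℂ) - 1) *
        LSeries (fun N ↦ if Squarefree N ∧ N % 4 = 3 ∧ (2 ∣ m → N % 8 = 7) ∧
            (∀ q : ℕ, q.Prime → q ∣ m → q ≠ 2 → J(-((N : ℕ) : ℤ) | q) = 1) ∧ ¬ 3 ∣ N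
          then (J(((n : ℕ) : ℤ) | N) : ℂ) else 0) σ)
      (𝓝[>] 1)
      (𝓝 (if IsSquare n then
          LSeries (fun g ↦ if g.Coprime (6 * m * n) then (μ g : ℂ) else 0) 2 *
            ((if 2 ∣ m then 1 / 8 else 1 / 4) * (if 3 ∣ m then 1 else 2 / 3) *
              (∏ q ∈ m.primeFactors.erase 2, ((q : ℂ) - 1) / (2 * q)) *
              ∏ ℓ ∈ n.primeFactors \ (6 * m).primeFactors, (1 - 1 / (ℓ : ℂ)))
        else 0)) := by
  -- the periodic weight, the odd primes of `3mn`, the period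
  set w : ℕ → ℂ := fun N ↦ if N % 4 = 3 ∧ (2 ∣ m → N % 8 = 7) ∧
      (∀ q : ℕ, q.Prime → q ∣ m → q ≠ 2 → J(-((N : ℕ) : ℤ) | q) = 1) ∧ ¬ 3 ∣ N
    then (J(((n : ℕ) : ℤ) | N) : ℂ) else 0 with hw_def
  set S : Finset ℕ := (3 * m * n).primeFactors.erase 2 with hS
  set Q : ℕ := 8 * ∏ ℓ ∈ S, ℓ with hQ
  have hSP : ∀ ℓ ∈ S, ℓ.Prime ∧ ℓ ≠ 2 := fun ℓ hℓ ↦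
    ⟨Nat.prime_of_mem_primeFactors (Finset.mem_of_mem_erase hℓ), Finset.ne_of_mem_erase hℓ⟩
  have hQ0 : Q ≠ 0 := mul_ne_zero (by norm_num) (Finset.prod_ne_zero_iff.mpr fun ℓ hℓ ↦ (hSP ℓ hℓ).1.ne_zero)
  haveI : NeZero Q := ⟨hQ0⟩
  -- the analytic core
  have hper : Function.Periodic w Q := periodic_familyWeight hm hn
  have hsq : ∀ g b : ℕ, g ≠ 0 → b ≠ 0 → w (g ^ 2 * b) = if g.Coprime (6 * m * n) then w b else 0 :=
    fun g b hg hb ↦ familyWeight_sq_mul m n hg hb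
  have key := tendsto_sub_one_mul_LSeries_squarefree hper hsq
  have hsummand : (fun N ↦ if Squarefree N then w N else 0) = fun N ↦
      if Squarefree N ∧ N % 4 = 3 ∧ (2 ∣ m → N % 8 = 7) ∧
          (∀ q : ℕ, q.Prime → q ∣ m → q ≠ 2 → J(-((N : ℕ) : ℤ) | q) = 1) ∧ ¬ 3 ∣ N
        then (J(((n : ℕ) : ℤ) | N) : ℂ) else 0 := by
    funext N
    by_cases hsf : Squarefree N
    · simp only [hsf, true_and, if_true, hw_def]
    · simp only [hsf, false_and, if_false]
  rw [hsummand] at key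
  -- the local blocks
  set u : ℕ → ℂ := fun N ↦ if N % 4 = 3 ∧ (2 ∣ m → N % 8 = 7) then (J(2 | N) : ℂ) ^ n.factorization 2 else 0
    with hu_def
  set lam : ℕ → ℕ → ℂ := fun ℓ N ↦ if (ℓ = 3 → ¬ 3 ∣ N) ∧ (ℓ ∣ m → J(-((N : ℕ) : ℤ) | ℓ) = 1)
    then (J(((N : ℕ) : ℤ) | ℓ) : ℂ) ^ n.factorization ℓ else 0 with hlam_def
  set sgn : ℂ := (-1 : ℂ) ^ (ordCompl[2] n / 2) with hsgn_def
  have hu : Function.Periodic u 8 := periodic_eight_block m (n.factorization 2)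
  have hlam : ∀ ℓ ∈ S, Function.Periodic (lam ℓ) ℓ := fun ℓ _ ↦ periodic_prime_block m ℓ (n.factorization ℓ)
  have hfac : ∀ N, w N = sgn * u N * ∏ ℓ ∈ S, lam ℓ N := fun N ↦ familyWeight_eq_sign_mul_prod hm hn N
  -- the closed-form local values
  set f : ℕ → ℂ := fun ℓ ↦ if ℓ = 3 then (if 3 ∣ m then (-1 : ℂ) ^ n.factorization 3 else 1 + (-1 : ℂ) ^ n.factorization 3)
    else if ℓ ∣ m then ((ℓ : ℂ) - 1) / 2 else (if Even (n.factorization ℓ) then (ℓ : ℂ) - 1 else 0) with hf_def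
  have hU : ∑ j ∈ Finset.range 8, u j = if 2 ∣ m then 1 else 1 + (-1 : ℂ) ^ n.factorization 2 :=
    sum_range_eight_block (2 ∣ m) _
  have h3S : 3 ∈ S := Finset.mem_erase.mpr ⟨by norm_num, Nat.mem_primeFactors.mpr
    ⟨Nat.prime_three, ⟨m * n, by ring⟩, mul_ne_zero (mul_ne_zero three_ne_zero hm) hn⟩⟩
  have hL : ∀ ℓ ∈ S, ∑ j ∈ Finset.range ℓ, lam ℓ j = f ℓ := by
    intro ℓ hℓ
    obtain ⟨hℓp, hℓ2⟩ := hSP ℓ hℓ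
    by_cases hℓ3 : ℓ = 3
    · subst hℓ3
      have h := sum_range_three_block (3 ∣ m) (n.factorization 3)
      simp only [hf_def, if_true]
      rw [← h]
      refine Finset.sum_congr rfl fun j _ ↦ ?_
      simp only [hlam_def, forall_true_left]
    · simp only [hf_def, hℓ3, if_false]
      by_cases hℓm : ℓ ∣ m
      · rw [if_pos hℓm]
        have hv : n.factorization ℓ = 0 :=
          Nat.factorization_eq_zero_of_not_dvd fun hℓn ↦
            (Nat.Prime.coprime_iff_not_dvd hℓp).mp (Nat.Coprime.coprime_dvd_left hℓn hmn) hℓm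
        rw [← sum_range_ite_jacobiSym_neg_eq hℓp hℓ2]
        refine Finset.sum_congr rfl fun j _ ↦ ?_
        simp only [hlam_def, hℓ3, false_implies, true_and, hℓm, forall_true_left, hv, pow_zero]
      · rw [if_neg hℓm]
        have hℓn : ℓ ∣ n := by
          have h3mn : ℓ ∣ 3 * m * n := Nat.dvd_of_mem_primeFactors (Finset.mem_of_mem_erase hℓ)
          rcases (Nat.Prime.dvd_mul hℓp).mp h3mn with h3m | h
          · rcases (Nat.Prime.dvd_mul hℓp).mp h3m with h3 | h
            · exact absurd ((Nat.prime_dvd_prime_iff_eq hℓp Nat.prime_three).mp h3) hℓ3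
            · exact absurd h hℓm
          · exact h
        have hv : n.factorization ℓ ≠ 0 := (hℓp.factorization_pos_of_dvd hn hℓn).ne'
        rw [← sum_range_jacobiSym_pow hℓp hℓ2 hv]
        refine Finset.sum_congr rfl fun j _ ↦ ?_
        simp only [hlam_def, hℓ3, false_implies, true_and, hℓm, if_true]
  -- the mean over one period
  have hsum : ∑ j ∈ Finset.range Q, w j = sgn * ((∑ j ∈ Finset.range 8, u j) * ∏ ℓ ∈ S, f ℓ) := by
    calc ∑ j ∈ Finset.range Q, w j = ∑ j ∈ Finset.range Q, sgn * (u j * ∏ ℓ ∈ S, lam ℓ j) :=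
          Finset.sum_congr rfl fun j _ ↦ by rw [hfac j, mul_assoc]
      _ = sgn * ((∑ j ∈ Finset.range 8, u j) * ∏ ℓ ∈ S, ∑ j ∈ Finset.range ℓ, lam ℓ j) := by
          rw [← Finset.mul_sum, hQ, sum_range_mul_prod_eq S hSP u hu lam hlam]
      _ = sgn * ((∑ j ∈ Finset.range 8, u j) * ∏ ℓ ∈ S, f ℓ) := by
          rw [Finset.prod_congr rfl hL]
  have hQC : (Q : ℂ) = 8 * ∏ ℓ ∈ S, (ℓ : ℂ) := by rw [hQ]; push_cast; ring
  have hmean : (∑ j ∈ Finset.range Q, w j) / (Q : ℂ) = if IsSquare n then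
      ((if 2 ∣ m then 1 / 8 else 1 / 4) * (if 3 ∣ m then 1 else 2 / 3) *
        (∏ q ∈ m.primeFactors.erase 2, ((q : ℂ) - 1) / (2 * q)) *
        ∏ ℓ ∈ n.primeFactors \ (6 * m).primeFactors, (1 - 1 / (ℓ : ℂ))) else 0 := by
    rw [hsum, hU]
    have h3mn0 : 3 * m * n ≠ 0 := mul_ne_zero (mul_ne_zero three_ne_zero hm) hn
    by_cases hsqn : IsSquare n
    · -- `n` a square: all exponents even, the sign is `+1`
      rw [if_pos hsqn]
      have hev : ∀ p, Even (n.factorization p) := even_factorization_of_isSquare' hsqn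
      have hsgn : sgn = 1 := by rw [hsgn_def, (even_ordCompl_two_div_two hn hsqn).neg_one_pow]
      rw [hsgn, one_mul, hQC]
      -- the pieces of `S`: `3`, the odd primes of `m` other than `3`, the primes of `n` outside `6m`
      set A : Finset ℕ := (S.erase 3).filter (fun ℓ ↦ ℓ ∣ m) with hA_def
      set B : Finset ℕ := (S.erase 3).filter (fun ℓ ↦ ¬ ℓ ∣ m) with hB_def
      have hA : A = (m.primeFactors.erase 2).erase 3 := by
        ext ℓ
        simp only [hA_def, hS, Finset.mem_filter, Finset.mem_erase, Nat.mem_primeFactors]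
        constructor
        · rintro ⟨⟨hℓ3, hℓ2, hℓp, -, -⟩, hℓm⟩
          exact ⟨hℓ3, hℓ2, hℓp, hℓm, hm⟩
        · rintro ⟨hℓ3, hℓ2, hℓp, hℓm, -⟩
          exact ⟨⟨hℓ3, hℓ2, hℓp, dvd_mul_of_dvd_left (dvd_mul_of_dvd_right hℓm 3) n, h3mn0⟩, hℓm⟩
      have hB : B = n.primeFactors \ (6 * m).primeFactors := by
        ext ℓ
        simp only [hB_def, hS, Finset.mem_filter, Finset.mem_erase, Finset.mem_sdiff, Nat.mem_primeFactors]
        constructor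
        · rintro ⟨⟨hℓ3, hℓ2, hℓp, hℓ3mn, -⟩, hℓm⟩
          have hℓn : ℓ ∣ n := by
            rcases (Nat.Prime.dvd_mul hℓp).mp hℓ3mn with h3m | h
            · rcases (Nat.Prime.dvd_mul hℓp).mp h3m with h3 | h
              · exact absurd ((Nat.prime_dvd_prime_iff_eq hℓp Nat.prime_three).mp h3) hℓ3
              · exact absurd h hℓm
            · exact h
          refine ⟨⟨hℓp, hℓn, hn⟩, fun ⟨_, h6m, _⟩ ↦ ?_⟩
          rcases (Nat.Prime.dvd_mul hℓp).mp h6m with h6 | h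
          · have h6' : ℓ ∣ 2 * 3 := by simpa using h6
            rcases (Nat.Prime.dvd_mul hℓp).mp h6' with h2 | h3
            · exact hℓ2 ((Nat.prime_dvd_prime_iff_eq hℓp Nat.prime_two).mp h2)
            · exact hℓ3 ((Nat.prime_dvd_prime_iff_eq hℓp Nat.prime_three).mp h3)
          · exact hℓm h
        · rintro ⟨⟨hℓp, hℓn, -⟩, h6⟩
          have h6' : ¬ ℓ ∣ 6 * m := fun h ↦ h6 ⟨hℓp, h, mul_ne_zero (by norm_num) hm⟩
          refine ⟨⟨fun h ↦ h6' (h ▸ ⟨2 * m, by ring⟩), fun h ↦ h6' (h ▸ ⟨3 * m, by ring⟩), hℓp,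
            dvd_mul_of_dvd_right hℓn _, h3mn0⟩, fun h ↦ h6' (dvd_mul_of_dvd_right h 6)⟩
      -- split the products over `S`
      have hsplit : ∏ ℓ ∈ S, f ℓ = f 3 * ((∏ ℓ ∈ A, f ℓ) * ∏ ℓ ∈ B, f ℓ) := by
        rw [hA_def, hB_def, Finset.prod_filter_mul_prod_filter_not]
        exact (Finset.mul_prod_erase S f h3S).symm
      have hsplitN : ∏ ℓ ∈ S, (ℓ : ℂ) = ((3 : ℕ) : ℂ) * ((∏ ℓ ∈ A, (ℓ : ℂ)) * ∏ ℓ ∈ B, (ℓ : ℂ)) := by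
        rw [hA_def, hB_def, Finset.prod_filter_mul_prod_filter_not]
        exact (Finset.mul_prod_erase S (fun ℓ : ℕ ↦ (ℓ : ℂ)) h3S).symm
      -- evaluate `f` on each piece
      have hf3 : f 3 = if 3 ∣ m then 1 else 2 := by
        simp only [hf_def, if_true, (hev 3).neg_one_pow]
        split_ifs <;> norm_num
      have hfA : ∀ ℓ ∈ A, f ℓ = ((ℓ : ℂ) - 1) / 2 := by
        intro ℓ hℓ
        rw [hA_def, Finset.mem_filter, Finset.mem_erase] at hℓ
        simp only [hf_def, hℓ.1.1, if_false, hℓ.2, if_true]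
      have hfB : ∀ ℓ ∈ B, f ℓ = (ℓ : ℂ) - 1 := by
        intro ℓ hℓ
        rw [hB_def, Finset.mem_filter, Finset.mem_erase] at hℓ
        simp only [hf_def, hℓ.1.1, if_false, hℓ.2, hev ℓ, if_true]
      have hB1 : ∀ ℓ ∈ B, (1 - 1 / (ℓ : ℂ)) = ((ℓ : ℂ) - 1) / ℓ := by
        intro ℓ hℓ
        have hℓ0 : (ℓ : ℂ) ≠ 0 := Nat.cast_ne_zero.mpr (hSP ℓ (Finset.mem_of_mem_erase
          (Finset.mem_of_mem_filter ℓ hℓ))).1.ne_zero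
        field_simp
      have hAq : ∀ q ∈ A, ((q : ℂ) - 1) / (2 * q) = (((q : ℂ) - 1) / 2) / q := by
        intro q _
        rw [div_div]
      have hU2 : (if 2 ∣ m then (1 : ℂ) else 1 + (-1 : ℂ) ^ n.factorization 2) = if 2 ∣ m then 1 else 2 := by
        split_ifs
        · rfl
        · rw [(hev 2).neg_one_pow]; norm_num
      -- the product over the odd primes of `m`
      have hPm : ∏ q ∈ m.primeFactors.erase 2, ((q : ℂ) - 1) / (2 * q) =
          (if 3 ∣ m then ((3 : ℂ) - 1) / (2 * 3) else 1) * ∏ q ∈ A, (((q : ℂ) - 1) / 2) / q := by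
        rw [← Finset.prod_congr rfl hAq, hA]
        by_cases h3m : 3 ∣ m
        · rw [if_pos h3m]
          have h3mem : 3 ∈ m.primeFactors.erase 2 :=
            Finset.mem_erase.mpr ⟨by norm_num, Nat.mem_primeFactors.mpr ⟨Nat.prime_three, h3m, hm⟩⟩
          rw [← Finset.mul_prod_erase _ _ h3mem]
          push_cast
          ring
        · have h3nm : 3 ∉ m.primeFactors.erase 2 := fun h ↦
            h3m (Nat.dvd_of_mem_primeFactors (Finset.mem_of_mem_erase h))
          rw [if_neg h3m, one_mul, Finset.erase_eq_of_notMem h3nm]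
      rw [hsplit, hsplitN, Finset.prod_congr rfl hfA, Finset.prod_congr rfl hfB, hf3, hU2]
      set X := ∏ q ∈ A, (((q : ℂ) - 1) / 2) with hX
      set Y := ∏ q ∈ A, (q : ℂ) with hY'
      set Z := ∏ ℓ ∈ B, ((ℓ : ℂ) - 1) with hZ
      set T := ∏ ℓ ∈ B, (ℓ : ℂ) with hT'
      have hXA : ∏ q ∈ A, (((q : ℂ) - 1) / 2) / q = X / Y := Finset.prod_div_distrib _ _
      have hZB : ∏ ℓ ∈ n.primeFactors \ (6 * m).primeFactors, (1 - 1 / (ℓ : ℂ)) = Z / T := by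
        rw [← hB, Finset.prod_congr rfl hB1]
        exact Finset.prod_div_distrib _ _
      have hY : Y ≠ 0 := Finset.prod_ne_zero_iff.mpr fun q hq ↦
        Nat.cast_ne_zero.mpr (hSP q (Finset.mem_of_mem_erase (Finset.mem_of_mem_filter q hq))).1.ne_zero
      have hT : T ≠ 0 := Finset.prod_ne_zero_iff.mpr fun ℓ hℓ ↦
        Nat.cast_ne_zero.mpr (hSP ℓ (Finset.mem_of_mem_erase (Finset.mem_of_mem_filter ℓ hℓ))).1.ne_zero
      rw [hPm, hXA, hZB]
      push_cast
      by_cases h2m : 2 ∣ m <;> by_cases h3m : 3 ∣ m <;>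
        simp only [h2m, h3m, if_true, if_false] <;> field_simp <;> ring
    · -- `n` not a square: a prime with odd exponent kills one factor
      rw [if_neg hsqn]
      obtain ⟨p, hp, hodd⟩ := exists_mem_primeFactors_odd_factorization hn hsqn
      have hpp : p.Prime := Nat.prime_of_mem_primeFactors hp
      have hpn : p ∣ n := Nat.dvd_of_mem_primeFactors hp
      have hpm : ¬ p ∣ m := fun hpm' ↦
        (Nat.Prime.coprime_iff_not_dvd hpp).mp (Nat.Coprime.coprime_dvd_left hpn hmn) hpm'
      suffices h0 : (if 2 ∣ m then (1 : ℂ) else 1 + (-1 : ℂ) ^ n.factorization 2) * ∏ ℓ ∈ S, f ℓ = 0 by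
        rw [h0, mul_zero, zero_div]
      by_cases hp2 : p = 2
      · subst hp2
        rw [if_neg hpm, hodd.neg_one_pow]
        ring
      by_cases hp3 : p = 3
      · subst hp3
        rw [Finset.prod_eq_zero h3S, mul_zero]
        simp only [hf_def, if_true, if_neg hpm, hodd.neg_one_pow]
        ring
      · have hpS : p ∈ S := Finset.mem_erase.mpr ⟨hp2, Nat.mem_primeFactors.mpr
          ⟨hpp, dvd_mul_of_dvd_right hpn _, h3mn0⟩⟩
        rw [Finset.prod_eq_zero hpS, mul_zero]
        simp only [hf_def, hp3, if_false, hpm, Nat.not_even_iff_odd.mpr hodd]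
  rw [hmean, mul_ite, mul_zero] at key
  exact key

/-- **LEMMA D, Euler form** (w5 g5's `dens(F)·∏_{ℓ^v ∥ n} c_ℓ(v)`, `c_ℓ(v) = [v even]·ℓ/(ℓ+1)`): the same limit with the
`n`-dependence of the density constant pulled out as the finite Euler factor `∏_{ℓ ∣ n, ℓ ∤ 6m} ℓ/(ℓ+1)`:
`lim_{σ→1⁺} (σ−1)·Σ_N (n/N) N^{−σ} = [n = □] · L(𝟙_{⊥6m}·μ, 2) · c₂ · c₃ · ∏_{q ∣ m, q odd} (q−1)/(2q) · ∏_{ℓ ∣ n, ℓ ∤ 6m} ℓ/(ℓ+1)`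
(`m, n ≥ 1`, `n ⊥ m`; `L(𝟙_{⊥6m}·μ, 2) = ∏_{ℓ ∤ 6m}(1 − ℓ^{−2})`). [folklore] -/
theorem tendsto_sub_one_mul_LSeries_family_euler {m n : ℕ} (hm : m ≠ 0) (hn : n ≠ 0) (hmn : n.Coprime m) :
    Tendsto (fun σ : ℝ ↦ ((σ : ℂ) - 1) *
        LSeries (fun N ↦ if Squarefree N ∧ N % 4 = 3 ∧ (2 ∣ m → N % 8 = 7) ∧
            (∀ q : ℕ, q.Prime → q ∣ m → q ≠ 2 → J(-((N : ℕ) : ℤ) | q) = 1) ∧ ¬ 3 ∣ N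
          then (J(((n : ℕ) : ℤ) | N) : ℂ) else 0) σ)
      (𝓝[>] 1)
      (𝓝 (if IsSquare n then
          LSeries (fun g ↦ if g.Coprime (6 * m) then (μ g : ℂ) else 0) 2 *
            ((if 2 ∣ m then 1 / 8 else 1 / 4) * (if 3 ∣ m then 1 else 2 / 3) *
              (∏ q ∈ m.primeFactors.erase 2, ((q : ℂ) - 1) / (2 * q)) *
              ∏ ℓ ∈ n.primeFactors \ (6 * m).primeFactors, ((ℓ : ℂ) / (ℓ + 1)))
        else 0)) := by
  have key := tendsto_sub_one_mul_LSeries_family hm hn hmn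
  have hIV := LSeries_coprimeMoebius_six_mul_eq_prod_mul hm hn (s := 2) (by norm_num)
  set T : Finset ℕ := n.primeFactors \ (6 * m).primeFactors with hT_def
  have hT2 : ∀ ℓ ∈ T, (2 : ℕ) ≤ ℓ := fun ℓ hℓ ↦
    (Nat.prime_of_mem_primeFactors (Finset.mem_sdiff.mp hℓ).1).two_le
  -- termwise: `(1 − ℓ^{−2}) · ℓ/(ℓ+1) = 1 − 1/ℓ`
  have hterm : ∀ ℓ ∈ T, (1 - (ℓ : ℂ) ^ (-(2 : ℂ))) * ((ℓ : ℂ) / (ℓ + 1)) = 1 - 1 / (ℓ : ℂ) := by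
    intro ℓ hℓ
    have hℓ0 : (ℓ : ℂ) ≠ 0 := Nat.cast_ne_zero.mpr (by have := hT2 ℓ hℓ; omega)
    have hℓ1 : (ℓ : ℂ) + 1 ≠ 0 := by
      have : ((ℓ + 1 : ℕ) : ℂ) ≠ 0 := Nat.cast_ne_zero.mpr (Nat.succ_ne_zero ℓ)
      simpa using this
    rw [Complex.cpow_neg, Complex.cpow_two]
    field_simp
    ring
  have hprod : (∏ ℓ ∈ T, (1 - (ℓ : ℂ) ^ (-(2 : ℂ)))) * ∏ ℓ ∈ T, ((ℓ : ℂ) / (ℓ + 1)) =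
      ∏ ℓ ∈ T, (1 - 1 / (ℓ : ℂ)) := by
    rw [← Finset.prod_mul_distrib]
    exact Finset.prod_congr rfl hterm
  convert key using 3
  rw [hIV, ← hprod]
  ring

end Summit.BirchSwinnertonDyer.BirchSwinnertonDyer.Theorems.PrintCFram.FamilyMean
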